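import Literature.NumberTheory.Automorphic.LocalLanglandsGL
import HarnessLib

/-!
# Proofs for `LocalLanglandsGL`: the bridge `IsLocalLanglandsGL.weak`

This file discharges, sorry-free, the named fact
`Literature.NumberTheory.Automorphic.IsLocalLanglandsGL.weak` of
`Literature/NumberTheory/Automorphic/LocalLanglandsGL.lean`
(`IsLocalLanglandsGL.weak_holds`): a class-level local Langlands correspondence
`rec_n : Irr(GL_n(F)) → {Frobenius-semisimple n-dimensional Weil–Deligne representations}/≅`
(`IsLocalLanglandsGL F … d 𝓔 rec`; Harris–Taylor, *The geometry and cohomology of some simple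
Shimura varieties* (2001), Thm A) yields a representation-level family `rec'_n ρ` which is
Frobenius-semisimple-valued, isomorphism invariant, bijective from smooth irreducibles onto
Frobenius-semisimple classes, and represents `rec_n [π]` on every irreducible smooth `π` —
the bijectivity clauses (a)–(c) of the weak form `localLanglands_gl_weak` (`PAdicReps`).

The argument is the formal one recorded in the docstring of `IsLocalLanglandsGL.weak`: put
`rec'_n ρ := (rec_n [ρ]).out` if `ρ` is smooth irreducible and `rec'_n ρ := trivial` otherwise.

* (a) `.out` lands in the Frobenius-semisimple subtype; the trivial Weil–Deligne representation
  has `ρ(w) = id`, a semisimple endomorphism (`Module.End.isSemisimple_id`).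
* (b) irreducibility (`Representation.Equiv.isIrreducible_iff`, I4) and smoothness
  (`Representation.IsSmooth.of_equiv`, proved here: the stabiliser of `w` in `σ` is the
  stabiliser of `e⁻¹ w` in `ρ`) transport along `e : ρ ≃ ρ'`, and isomorphic smooth
  irreducibles have the same class (`IrrClass.mk_eq_mk_of_equiv`).
* (c) surjectivity of `rec_n` and `Quotient.mk_out`.
* (d) `rec'_n π ≅ rec'_n π'` is `(rec_n [π]).out ≈ (rec_n [π']).out`, so `rec_n [π] = rec_n [π']`
  (`Quotient.out_equiv_out`), hence `[π] = [π']` by injectivity, i.e. `π ≅ π'`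
  (`IrrClass.mk_eq_mk_iff`).
* (e) `rec'_n π = (rec_n [π]).out` by construction (structure eta for `SmoothIrrep`).

The file contains theorems only (no new definitions, no new named facts).

## References

* M. Harris, R. Taylor, *The geometry and cohomology of some simple Shimura varieties*, Annals
  of Math. Studies 151 (2001), Theorem A (Introduction) and VII.2.20.
* C. J. Bushnell, G. Henniart, *The local Langlands conjecture for `GL(2)`*, Grundlehren 335
  (2006), §1.1 (smooth representations and their isomorphisms).
-/

noncomputable section

open scoped MatrixGroups

namespace Literature.NumberTheory.Automorphic

/-! ### Smoothness is an isomorphism invariant -/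

/-- Smoothness transports along an isomorphism of representations: for a `G`-equivariant linear
isomorphism `e : ρ ≃ σ`, the stabiliser of `w` in `σ` is the stabiliser of `e⁻¹ w` in `ρ`, so
`σ` is smooth as soon as `ρ` is.  (Bushnell–Henniart, *The local Langlands conjecture for
`GL(2)`* (2006), §1.1; folklore.) [folklore] -/
theorem _root_.Representation.IsSmooth.of_equiv {k G V W : Type*} [CommRing k] [Group G]
    [AddCommGroup V] [Module k V] [AddCommGroup W] [Module k W] [TopologicalSpace G]
    {ρ : Representation k G V} {σ : Representation k G W} (hρ : ρ.IsSmooth)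
    (e : ρ.Equiv σ) : σ.IsSmooth := by
  intro w
  have hst : (σ.stabilizerSubgroup w : Set G) = (ρ.stabilizerSubgroup (e.symm w) : Set G) := by
    ext g
    have h1 := e.toIntertwiningMap.isIntertwining ρ σ g (e.symm w)
    rw [Representation.Equiv.coe_toIntertwiningMap, Representation.Equiv.apply_symm_apply] at h1
    simp only [SetLike.mem_coe, Representation.mem_stabilizerSubgroup]
    constructor
    · intro hg
      rw [← e.symm_apply_apply (ρ g (e.symm w)), h1, hg]
    · intro hg
      rw [← h1, hg, Representation.Equiv.apply_symm_apply]
  change IsOpen (σ.stabilizerSubgroup w : Set G)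
  rw [hst]
  exact hρ (e.symm w)

/-- Smoothness is invariant under isomorphism of representations (both directions of
`Representation.IsSmooth.of_equiv`).  (Bushnell–Henniart (2006), §1.1; folklore.) [folklore] -/
theorem _root_.Representation.Equiv.isSmooth_iff {k G V W : Type*} [CommRing k] [Group G]
    [AddCommGroup V] [Module k V] [AddCommGroup W] [Module k W] [TopologicalSpace G]
    {ρ : Representation k G V} {σ : Representation k G W} (e : ρ.Equiv σ) :
    ρ.IsSmooth ↔ σ.IsSmooth :=
  ⟨fun h => h.of_equiv e, fun h => h.of_equiv e.symm⟩

/-! ### lang.S09, bridge to the weak form: discharge -/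

section S09

variable {F : Type} [Field F] [ValuativeRel F] [TopologicalSpace F] [IsNonarchimedeanLocalField F]

variable (hmul : GaloisRepresentations.IsFrobPow.mul (F := F))
  (huniq : GaloisRepresentations.IsFrobPow.unique (F := F))
  (hn : GaloisRepresentations.absInertia_normal F)
  (hex : GaloisRepresentations.exists_isFrobPow (F := F))
  (hns : GaloisRepresentations.WeilGroup.exists_subgroup_le_inertia_isOpen_of_continuous (F := F))

/-- **Discharge of the bridge `IsLocalLanglandsGL.weak`** (Harris–Taylor, *The geometry and
cohomology of some simple Shimura varieties* (2001), Thm A: `rec_K` is a bijection from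
isomorphism classes of irreducible admissible representations of `GL_n(K)` onto isomorphism
classes of `n`-dimensional Frobenius-semisimple Weil–Deligne representations of `W_K`; here
only the formal passage from classes to representations is performed).  Given a class-level
local Langlands correspondence `rec` (`IsLocalLanglandsGL`), put
`rec'_n ρ := (rec_n [ρ]).out` if `ρ` is smooth irreducible and `rec'_n ρ := trivial` otherwise.
Then (a) every value is Frobenius-semisimple (`.out` lands in the Frobenius-semisimple subtype;
the trivial representation has `ρ(w) = id` semisimple); (b) `rec'` is isomorphism invariant,
because irreducibility (`Representation.Equiv.isIrreducible_iff`) and smoothness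
(`Representation.IsSmooth.of_equiv`) transport along `ρ ≃ ρ'` and isomorphic smooth irreducibles
have the same class; (c) `rec'_n` reaches every Frobenius-semisimple class (surjectivity of
`rec_n`, `Quotient.mk_out`); (d) `rec'_n π ≅ rec'_n π'` forces `rec_n [π] = rec_n [π']`
(`Quotient.out_equiv_out`), hence `[π] = [π']` (injectivity of `rec_n`), i.e. `π ≅ π'`;
(e) `rec'_n π = (rec_n [π]).out` by construction. [cite: HarrisTaylor2001, Thm A] -/
theorem IsLocalLanglandsGL.weak_holds : IsLocalLanglandsGL.weak hmul huniq hn hex hns := by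
  intro d 𝓔 rec h
  classical
  -- The representation-level family, abstracted together with its two defining equations.
  obtain ⟨rec', hpos, hneg⟩ :
      ∃ rec' : (n : ℕ) → (V : Type) → [AddCommGroup V] → [Module ℂ V] →
          Representation ℂ (GL (Fin n) F) V →
            GaloisRepresentations.WeilDeligneRep F ℂ (Fin n → ℂ),
        (∀ (n : ℕ) (V : Type) [AddCommGroup V] [Module ℂ V]
            (ρ : Representation ℂ (GL (Fin n) F) V) (hρ : ρ.IsIrreducible ∧ ρ.IsSmooth),
            rec' n V ρ = (rec n (IrrClass.mk ⟨V, ρ, hρ.1, hρ.2⟩)).out.1) ∧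
        (∀ (n : ℕ) (V : Type) [AddCommGroup V] [Module ℂ V]
            (ρ : Representation ℂ (GL (Fin n) F) V), ¬ (ρ.IsIrreducible ∧ ρ.IsSmooth) →
            rec' n V ρ = GaloisRepresentations.WeilDeligneRep.trivial ℂ (Fin n → ℂ)) :=
    ⟨fun n V _ _ ρ => if hρ : ρ.IsIrreducible ∧ ρ.IsSmooth then
        (rec n (IrrClass.mk ⟨V, ρ, hρ.1, hρ.2⟩)).out.1
      else GaloisRepresentations.WeilDeligneRep.trivial ℂ (Fin n → ℂ),
      fun n V _ _ ρ hρ => dif_pos hρ, fun n V _ _ ρ hρ => dif_neg hρ⟩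
  refine ⟨rec', fun n => ?_⟩
  -- (e) on a bundled smooth irreducible `π`, `rec'` is `(rec [π]).out` (structure eta).
  have he : ∀ π : SmoothIrrep (GL (Fin n) F),
      rec' n π.V π.ρ = (rec n (IrrClass.mk π)).out.1 := fun π =>
    hpos n π.V π.ρ ⟨π.isIrreducible, π.isSmooth⟩
  refine ⟨?_, ?_, ?_, ?_, he⟩
  · -- (a) Frobenius-semisimplicity
    intro V _ _ ρ
    by_cases hρ : ρ.IsIrreducible ∧ ρ.IsSmooth
    · rw [hpos n V ρ hρ]
      exact (rec n _).out.2
    · rw [hneg n V ρ hρ]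
      intro w
      exact Module.End.isSemisimple_id
  · -- (b) isomorphism invariance
    rintro V _ _ V' _ _ ρ ρ' ⟨e⟩
    by_cases hρ : ρ.IsIrreducible ∧ ρ.IsSmooth
    · have hρ' : ρ'.IsIrreducible ∧ ρ'.IsSmooth :=
        ⟨e.isIrreducible_iff.1 hρ.1, hρ.2.of_equiv e⟩
      rw [hpos n V ρ hρ, hpos n V' ρ' hρ',
        IrrClass.mk_eq_mk_of_equiv (r₁ := ⟨V, ρ, hρ.1, hρ.2⟩) (r₂ := ⟨V', ρ', hρ'.1, hρ'.2⟩) e]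
      exact GaloisRepresentations.WeilDeligneRep.IsEquivalent.refl _
    · have hρ' : ¬ (ρ'.IsIrreducible ∧ ρ'.IsSmooth) := fun h' =>
        hρ ⟨e.symm.isIrreducible_iff.1 h'.1, h'.2.of_equiv e.symm⟩
      rw [hneg n V ρ hρ, hneg n V' ρ' hρ']
      exact GaloisRepresentations.WeilDeligneRep.IsEquivalent.refl _
  · -- (c) surjectivity onto Frobenius-semisimple classes from smooth irreducibles
    intro r hr
    obtain ⟨c, hc⟩ := (h.bijective n).2 (Quotient.mk _ ⟨r, hr⟩)
    obtain ⟨π, rfl⟩ := IrrClass.mk_surjective c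
    refine ⟨π, ?_⟩
    rw [he π, hc]
    exact Quotient.mk_out (s := frobSemisimpleWDSetoid F n) ⟨r, hr⟩
  · -- (d) injectivity on smooth irreducibles
    intro π π' hππ'
    rw [he π, he π'] at hππ'
    have h1 : rec n (IrrClass.mk π) = rec n (IrrClass.mk π') :=
      Quotient.out_equiv_out.1 hππ'
    exact (IrrClass.mk_eq_mk_iff π π').1 ((h.bijective n).1 h1)

end S09

/-!
## Quasi-characters of `Fˣ` have open kernel: discharge of `isOpen_ker_quasiChar`

The second part of this file discharges the named fact
`Literature.NumberTheory.Automorphic.isOpen_ker_quasiChar` of `LocalLanglandsGL.lean`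
(`isOpen_ker_quasiChar_holds`): every continuous quasi-character `χ : Fˣ →ₜ* ℂˣ` of a
non-archimedean local field `F` has open kernel, i.e. is trivial on an open subgroup
`{u | v(u - 1) < γ}` of `Fˣ` (Bushnell–Henniart, *The local Langlands conjecture for `GL(2)`*
(2006), §1.1 and §1.5; Tate, *Number theoretic background*, Corvallis 1979, (2.2)).

Proof: `ℂˣ` has no small subgroups — a subgroup of `ℂˣ` inside the ball `‖z - 1‖ < 1` is
trivial (`Complex.units_eq_one_of_forall_norm_pow_sub_one_lt`: the powers of `z` and of `z⁻¹`
stay bounded, so `‖z‖ = 1`, and then repeated squaring multiplies `‖z - 1‖` by at least `3/2`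
while it stays `< 1`) — and every neighbourhood of `1` in `Fˣ` contains an open subgroup
`{u ∈ Fˣ | v(u - 1) < γ, v(u - 1) < 1}` (`exists_isOpen_subgroup_units_subset`, from
`IsValuativeTopology.mem_nhds_iff'` and `Units.isEmbedding_val₀`); the image of such a subgroup
of `χ⁻¹ {‖z - 1‖ < 1}` under `χ` is a subgroup of `ℂˣ` inside the ball, hence trivial, so `ker χ`
contains an open subgroup and is open (`Subgroup.isOpen_mono`). Theorems only (no new
definitions, no new named facts).

Mathlib declarations used: `ContinuousMonoidHom`, `Units.isEmbedding_val₀`,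
`IsValuativeTopology.mem_nhds_iff'`, `Valuation.map_add_lt`, `Valuation.map_add_eq_of_lt_left`,
`Valuation.map_sub_swap`, `Subgroup.isOpen_mono`, `Complex.normSq_add`, `Complex.normSq_sub`,
`pow_unbounded_of_one_lt`.
-/

section QuasiCharKernelDischarge

open scoped Topology
open Filter ValuativeRel

/-! ### `ℂˣ` has no small subgroups -/

section NoSmallSubgroups

/-- For `‖w‖ = 1` one has `‖w + 1‖² + ‖w - 1‖² = 4` (parallelogram law in `ℂ`). [folklore] -/
private lemma norm_add_one_sq_add_norm_sub_one_sq {w : ℂ} (hw : ‖w‖ = 1) :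
    ‖w + 1‖ ^ 2 + ‖w - 1‖ ^ 2 = 4 := by
  have h1 : Complex.normSq w = 1 := by
    rw [Complex.normSq_eq_norm_sq, hw, one_pow]
  rw [← Complex.normSq_eq_norm_sq, ← Complex.normSq_eq_norm_sq, Complex.normSq_add,
    Complex.normSq_sub, h1, map_one]
  ring

/-- Squaring pushes away from `1` on the unit circle near `1`: if `‖w‖ = 1` and `‖w - 1‖ < 1` then
`‖w ^ 2 - 1‖ ≥ (3/2) ‖w - 1‖`. [folklore] -/
private lemma norm_sq_sub_one_ge {w : ℂ} (hw : ‖w‖ = 1) (h : ‖w - 1‖ < 1) :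
    (3 / 2) * ‖w - 1‖ ≤ ‖w ^ 2 - 1‖ := by
  have hpar := norm_add_one_sq_add_norm_sub_one_sq hw
  have hsub : ‖w - 1‖ ^ 2 < 1 := by
    have h0 : 0 ≤ ‖w - 1‖ := norm_nonneg _
    nlinarith
  have hadd : (3 / 2 : ℝ) ≤ ‖w + 1‖ := by
    have h3 : (3 : ℝ) ≤ ‖w + 1‖ ^ 2 := by linarith
    have h0 : 0 ≤ ‖w + 1‖ := norm_nonneg _
    nlinarith
  have hfac : w ^ 2 - 1 = (w - 1) * (w + 1) := by ring
  rw [hfac, norm_mul]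
  calc (3 / 2) * ‖w - 1‖ = ‖w - 1‖ * (3 / 2) := by ring
    _ ≤ ‖w - 1‖ * ‖w + 1‖ := by gcongr

/-- Iterating: if `‖w‖ = 1` and all `‖w ^ (2 ^ k) - 1‖ < 1`, then
`(3/2) ^ k ‖w - 1‖ ≤ ‖w ^ (2 ^ k) - 1‖`. [folklore] -/
private lemma pow_mul_norm_sub_one_le {w : ℂ} (hw : ‖w‖ = 1)
    (h : ∀ k : ℕ, ‖w ^ (2 ^ k) - 1‖ < 1) (k : ℕ) :
    (3 / 2 : ℝ) ^ k * ‖w - 1‖ ≤ ‖w ^ (2 ^ k) - 1‖ := by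
  induction k with
  | zero => simp
  | succ k ih =>
    have hwk : ‖w ^ (2 ^ k)‖ = 1 := by rw [norm_pow, hw, one_pow]
    have hstep := norm_sq_sub_one_ge hwk (h k)
    rw [← pow_mul, ← pow_succ] at hstep
    calc (3 / 2 : ℝ) ^ (k + 1) * ‖w - 1‖ = (3 / 2) * ((3 / 2) ^ k * ‖w - 1‖) := by ring
      _ ≤ (3 / 2) * ‖w ^ (2 ^ k) - 1‖ := by gcongr
      _ ≤ ‖w ^ 2 ^ (k + 1) - 1‖ := hstep

/-- A complex number all of whose powers stay within distance `< 1` of `1` has norm at most `1`.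
[folklore] -/
private lemma norm_le_one_of_forall_norm_pow_sub_one_lt {w : ℂ}
    (h : ∀ n : ℕ, ‖w ^ n - 1‖ < 1) : ‖w‖ ≤ 1 := by
  by_contra hlt
  rw [not_le] at hlt
  obtain ⟨n, hn⟩ := pow_unbounded_of_one_lt (2 : ℝ) hlt
  have h2 : ‖w ^ n‖ < 2 := by
    calc ‖w ^ n‖ = ‖(w ^ n - 1) + 1‖ := by rw [sub_add_cancel]
      _ ≤ ‖w ^ n - 1‖ + ‖(1 : ℂ)‖ := norm_add_le _ _
      _ < 2 := by rw [norm_one]; linarith [h n]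
  rw [norm_pow] at h2
  exact lt_irrefl _ (hn.trans h2)

/-- **`ℂˣ` has no small subgroups**, pointwise form: if all powers of `z ∈ ℂˣ` and of `z⁻¹` lie
in the ball `‖· - 1‖ < 1`, then `z = 1`. Consequently a subgroup of `ℂˣ` contained in that ball
is trivial. (Tate, Corvallis 1979, (2.2); Bushnell–Henniart 2006, §1.5.) [folklore] -/
theorem Complex.units_eq_one_of_forall_norm_pow_sub_one_lt {z : ℂˣ}
    (h : ∀ n : ℕ, ‖((z ^ n : ℂˣ) : ℂ) - 1‖ < 1)
    (h' : ∀ n : ℕ, ‖((z⁻¹ ^ n : ℂˣ) : ℂ) - 1‖ < 1) : z = 1 := by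
  have hz : ∀ n : ℕ, ‖(z : ℂ) ^ n - 1‖ < 1 := fun n => by simpa using h n
  have hz' : ∀ n : ℕ, ‖((z⁻¹ : ℂˣ) : ℂ) ^ n - 1‖ < 1 := fun n => by simpa using h' n
  have hle : ‖(z : ℂ)‖ ≤ 1 := norm_le_one_of_forall_norm_pow_sub_one_lt hz
  have hle' : ‖((z⁻¹ : ℂˣ) : ℂ)‖ ≤ 1 := norm_le_one_of_forall_norm_pow_sub_one_lt hz'
  have hnorm : ‖(z : ℂ)‖ = 1 := by
    refine le_antisymm hle ?_
    have hzne : (z : ℂ) ≠ 0 := z.ne_zero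
    rw [Units.val_inv_eq_inv_val, norm_inv] at hle'
    have hpos : 0 < ‖(z : ℂ)‖ := norm_pos_iff.2 hzne
    rwa [inv_le_one₀ hpos] at hle'
  have hpow : ∀ k : ℕ, ‖(z : ℂ) ^ (2 ^ k) - 1‖ < 1 := fun k => hz (2 ^ k)
  have hmain := pow_mul_norm_sub_one_le hnorm hpow
  have hd0 : ‖(z : ℂ) - 1‖ = 0 := by
    by_contra hne
    have hpos : 0 < ‖(z : ℂ) - 1‖ := lt_of_le_of_ne (norm_nonneg _) (Ne.symm hne)
    obtain ⟨k, hk⟩ := pow_unbounded_of_one_lt (‖(z : ℂ) - 1‖⁻¹) (by norm_num : (1 : ℝ) < 3 / 2)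
    have h1 : 1 < (3 / 2 : ℝ) ^ k * ‖(z : ℂ) - 1‖ := by
      rw [← inv_mul_cancel₀ hpos.ne']
      exact mul_lt_mul_of_pos_right hk hpos
    exact lt_irrefl _ ((h1.trans_le (hmain k)).trans (hpow k))
  ext
  rw [Units.val_one]
  exact sub_eq_zero.1 (norm_eq_zero.1 hd0)

end NoSmallSubgroups

/-! ### Congruence subgroups of `Fˣ` and the discharge -/

section QuasiCharKernel

variable {F : Type*} [Field F] [ValuativeRel F] [TopologicalSpace F] [IsNonarchimedeanLocalField F]

/-- The ball `{z | v(z - 1) < γ}` around `1` is open in `F` (it is a neighbourhood of each of its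
points by the ultrametric inequality). [folklore] -/
private lemma isOpen_setOf_valuation_sub_one_lt (γ : (ValueGroupWithZero F)ˣ) :
    IsOpen {z : F | valuation F (z - 1) < γ} := by
  rw [isOpen_iff_mem_nhds]
  intro z₀ hz₀
  rw [IsValuativeTopology.mem_nhds_iff']
  refine ⟨γ, fun z hz => ?_⟩
  have : z - 1 = (z - z₀) + (z₀ - 1) := by ring
  simp only [Set.mem_setOf_eq] at hz hz₀ ⊢
  rw [this]
  exact Valuation.map_add_lt _ hz hz₀

/-- **Congruence subgroups form a basis of open subgroups at `1` in `Fˣ`**: every neighbourhood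
`V` of `1` in `Fˣ` contains an open subgroup, namely `{u | v(u - 1) < γ, v(u - 1) < 1}` for a
suitable `γ` (for `γ ≤ 1` this is `1 + 𝔭^k`; Bushnell–Henniart 2006, §1.1). The subgroup is built
inside the proof (closure under `*` and `⁻¹` by the ultrametric inequality, openness from
`Units.continuous_val`, smallness from `Units.isEmbedding_val₀` and
`IsValuativeTopology.mem_nhds_iff'`). [cite: BushnellHenniart2006, §1.1] -/
theorem exists_isOpen_subgroup_units_subset {V : Set Fˣ} (hV : V ∈ 𝓝 (1 : Fˣ)) :
    ∃ H : Subgroup Fˣ, IsOpen (H : Set Fˣ) ∧ (H : Set Fˣ) ⊆ V := by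
  rw [Units.isEmbedding_val₀.nhds_eq_comap, Filter.mem_comap] at hV
  obtain ⟨N, hN, hNV⟩ := hV
  rw [Units.val_one, IsValuativeTopology.mem_nhds_iff'] at hN
  obtain ⟨γ, hγ⟩ := hN
  -- `v(a) = 1` whenever `v(a - 1) < 1`
  have hval : ∀ a : Fˣ, valuation F ((a : F) - 1) < 1 → valuation F (a : F) = 1 := by
    intro a ha1
    have : (a : F) = 1 + ((a : F) - 1) := by ring
    rw [this, Valuation.map_add_eq_of_lt_left _ (by rwa [map_one]), map_one]
  let H : Subgroup Fˣ :=
    { carrier := {u | valuation F ((u : F) - 1) < γ ∧ valuation F ((u : F) - 1) < 1}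
      one_mem' := by
        simp only [Set.mem_setOf_eq, Units.val_one, sub_self, map_zero]
        exact ⟨zero_lt_iff.2 γ.ne_zero, zero_lt_one⟩
      mul_mem' := by
        rintro a b ⟨haγ, ha1⟩ ⟨hbγ, hb1⟩
        have hva := hval a ha1
        have hab : ((a * b : Fˣ) : F) - 1 = (a : F) * ((b : F) - 1) + ((a : F) - 1) := by
          push_cast; ring
        simp only [Set.mem_setOf_eq]
        rw [hab]
        refine ⟨Valuation.map_add_lt _ ?_ haγ, Valuation.map_add_lt _ ?_ ha1⟩
        · rwa [map_mul, hva, one_mul]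
        · rwa [map_mul, hva, one_mul]
      inv_mem' := by
        rintro a ⟨haγ, ha1⟩
        have hva := hval a ha1
        have hinv : ((a⁻¹ : Fˣ) : F) - 1 = ((a⁻¹ : Fˣ) : F) * (1 - (a : F)) := by
          rw [mul_sub, mul_one, Units.inv_mul]
        have hvinv : valuation F ((a⁻¹ : Fˣ) : F) = 1 := by
          have h := congrArg (valuation F) a.inv_mul
          rw [map_mul, map_one, hva, mul_one] at h
          exact h
        simp only [Set.mem_setOf_eq]
        rw [hinv, map_mul, hvinv, one_mul, Valuation.map_sub_swap]
        exact ⟨haγ, ha1⟩ }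
  refine ⟨H, ?_, fun u hu => hNV (hγ hu.1)⟩
  have hset : (H : Set Fˣ) =
      Units.val ⁻¹' ({z : F | valuation F (z - 1) < γ} ∩ {z : F | valuation F (z - 1) < 1}) := by
    ext u
    exact Iff.rfl
  rw [hset]
  exact ((isOpen_setOf_valuation_sub_one_lt γ).inter
    (by simpa using isOpen_setOf_valuation_sub_one_lt (F := F) 1)).preimage Units.continuous_val

/-- **Quasi-characters are smooth** (discharge of the named fact `isOpen_ker_quasiChar`): a
continuous `χ : Fˣ →ₜ* ℂˣ` has open kernel, because `χ⁻¹ {‖z - 1‖ < 1}` contains a congruence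
subgroup whose image, a subgroup of `ℂˣ` inside that ball, is trivial (no small subgroups).
(Bushnell–Henniart 2006, §1.1, §1.5; Tate, Corvallis 1979, (2.2).) [cite: BushnellHenniart2006, §1.5] -/
theorem isOpen_ker_quasiChar_holds : isOpen_ker_quasiChar (F := F) := by
  intro χ
  -- the open unit ball around `1` in `ℂˣ`, pulled back to `Fˣ`, contains an open subgroup `H`
  set U : Set ℂˣ := {z | ‖(z : ℂ) - 1‖ < 1} with hU
  have hUo : IsOpen U :=
    isOpen_lt (Units.continuous_val.sub continuous_const).norm continuous_const
  have h1U : (1 : ℂˣ) ∈ U := by simp [hU]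
  have hV : χ ⁻¹' U ∈ 𝓝 (1 : Fˣ) :=
    (hUo.preimage χ.continuous).mem_nhds (by simpa using h1U)
  obtain ⟨H, hHo, hHV⟩ := exists_isOpen_subgroup_units_subset hV
  -- `χ(H)` is a subgroup of `ℂˣ` inside the ball, hence trivial: `H ≤ ker χ`
  have hle : H ≤ (χ : Fˣ →* ℂˣ).ker := by
    intro u hu
    rw [MonoidHom.mem_ker]
    have hmem : ∀ w ∈ H, ‖((χ w : ℂˣ) : ℂ) - 1‖ < 1 := fun w hw => hHV hw
    refine Complex.units_eq_one_of_forall_norm_pow_sub_one_lt (fun n => ?_) (fun n => ?_)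
    · have := hmem (u ^ n) (pow_mem hu n)
      simpa [map_pow] using this
    · have := hmem (u⁻¹ ^ n) (pow_mem (inv_mem hu) n)
      simpa [map_pow, map_inv] using this
  exact Subgroup.isOpen_mono hle hHo

end QuasiCharKernel

end QuasiCharKernelDischarge

/-! ### Audit alias (binder order of the consumers) -/

/-- **Quasi-characters are smooth** — alias of `isOpen_ker_quasiChar_holds` stated with the binder
order `[Field F] [TopologicalSpace F] [ValuativeRel F]` used by the consumers of the named fact
`isOpen_ker_quasiChar` (`LocalLanglandsDatum.hqc`; the route support items `QuasiCharKernelOpen`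
of Langlands/AdjointEulerNumerical, CMFern, LiftDescend, ledger stmt-Langlands-10478), so that the
cone audit (`#h21_route_deps`, `statesExactly`) recognises the discharge; mathematically identical
to `isOpen_ker_quasiChar_holds` (Bushnell–Henniart 2006, §1.1, §1.5).
[cite: BushnellHenniart2006, §1.5] -/
theorem isOpen_ker_quasiChar.holds {F : Type*} [Field F] [TopologicalSpace F] [ValuativeRel F]
    [IsNonarchimedeanLocalField F] : isOpen_ker_quasiChar (F := F) :=
  isOpen_ker_quasiChar_holds

end Literature.NumberTheory.Automorphic
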